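import Mathlib.Analysis.Calculus.MeanValue
import Mathlib.Analysis.Calculus.ContDiff.Basic
import Mathlib.Analysis.InnerProductSpace.PiL2
import Mathlib.Topology.Homotopy.Basic
import Mathlib.Topology.UniformSpace.HeineCantor
import Summits.SmoothPoincare4.SmoothPoincare4.Theses.DottedCircleRasmussen

/-!
# Helper `helper_friendsCarrier_Vk_partA_pushHomotopy` (piece 7 of the registered stub
`helper_friendsCarrier_Vk_partA`, line `mk_friends`, skeleton v8) for crux `DcrGap`
(item stmt-SmoothPoincare4-16128, route route-SmoothPoincare4-DottedCircleRasmussen)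

**A family of loops shrinking to zero is homotopic, in the punctured plane, to its first-order term.**
The geometric reduction of the framing input of Part A reads the push-offs `νK(u, t e₀)` of the model knot
in the coordinates of the affine tube of the disc: a `C¹` family of plane loops `Ψ(u, t)` with `Ψ(u, 0) = 0`,
non-vanishing for `0 < t ≤ s`, whose `t`-derivative at `t = 0` is the comparison loop `L(u)` (the first
column of the matrix comparing the tube frame with the disc frame).  This file proves the first-order
homotopy: **`L` and `Ψ(·, s)` are freely homotopic in `ℝ² ∖ 0`.**  By the mean value inequality and uniform
continuity of `∂ₜΨ` on the compact `𝕊¹ × [0, s]`, `|Ψ(u, t₁) - t₁ L(u)| ≤ (c/2) t₁` for a small `t₁ > 0`,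
`c = min |L|`, so the straight segment from `L(u)` to `Ψ(u, t₁)` misses the origin; then `t` runs from `t₁`
to `s`.

* `FriendsCarrierVk.exists_pushHomotopy` / `helper_friendsCarrier_Vk_partA_pushHomotopy` — the statement.

No definitions, no named facts, no `sorry`.

## References

* M. W. Hirsch, *Differential Topology*, GTM 33 (1976), Ch. 4 §5 (fibre derivatives of tubular
  neighbourhoods; the linearisation along the zero section). [Hirsch1976]
-/

-- the prescribed namespace `Summit.<P>.<Sub>.…` duplicates `SmoothPoincare4` (P = Sub)
set_option linter.dupNamespace false
set_option linter.style.longLine false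

noncomputable section

open scoped ContDiff Topology unitInterval
open Set Function Metric Filter

namespace Summit.SmoothPoincare4.SmoothPoincare4.Theorems.DcrGap.MkFriends

namespace FriendsCarrierVk

/-- **First-order homotopy of a shrinking family of plane loops.** [cite: Hirsch1976, Ch. 4 §5] -/
theorem exists_pushHomotopy (Ψ : EuclideanSpace ℝ (Fin 2) × ℝ → EuclideanSpace ℝ (Fin 2)) (L : EuclideanSpace ℝ (Fin 2) → EuclideanSpace ℝ (Fin 2))
    (s : ℝ) (hs : 0 < s)
    (hΨ : ∀ u ∈ sphere (0 : EuclideanSpace ℝ (Fin 2)) 1, ∀ t ∈ Icc 0 s, ContDiffAt ℝ 1 Ψ (u, t))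
    (hΨ0 : ∀ u ∈ sphere (0 : EuclideanSpace ℝ (Fin 2)) 1, Ψ (u, 0) = 0)
    (hL : ∀ u ∈ sphere (0 : EuclideanSpace ℝ (Fin 2)) 1, fderiv ℝ Ψ (u, 0) ((0 : EuclideanSpace ℝ (Fin 2)), (1 : ℝ)) = L u)
    (hL0 : ∀ u ∈ sphere (0 : EuclideanSpace ℝ (Fin 2)) 1, L u ≠ 0) (hLc : ContinuousOn L (sphere 0 1))
    (hne : ∀ u ∈ sphere (0 : EuclideanSpace ℝ (Fin 2)) 1, ∀ t, 0 < t → t ≤ s → Ψ (u, t) ≠ 0) :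
    ∃ G : I × (sphere (0 : EuclideanSpace ℝ (Fin 2)) 1) → EuclideanSpace ℝ (Fin 2), Continuous G ∧ (∀ p, G p ≠ 0) ∧
      (∀ u, G (0, u) = L u) ∧ ∀ u, G (1, u) = Ψ (u, s) := by
  set S : Set (EuclideanSpace ℝ (Fin 2)) := sphere 0 1 with hS
  have hSc : IsCompact S := isCompact_sphere _ _
  -- the partial `t`-derivative and its continuity on `S × [0, s]`
  set D : EuclideanSpace ℝ (Fin 2) × ℝ → EuclideanSpace ℝ (Fin 2) := fun p => fderiv ℝ Ψ p ((0 : EuclideanSpace ℝ (Fin 2)), (1 : ℝ)) with hD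
  have hDc : ContinuousOn D (S ×ˢ Icc 0 s) := by
    rintro ⟨u, t⟩ ⟨hu, ht⟩
    have h := (hΨ u hu t ht).fderiv_right (m := 0) (by norm_num)
    exact (h.continuousAt.clm_apply continuousAt_const).continuousWithinAt
  have hΨc : ContinuousOn Ψ (S ×ˢ Icc 0 s) := fun p hp => (hΨ p.1 hp.1 p.2 hp.2).continuousAt.continuousWithinAt
  -- the positive minimum `c` of `|L|` on the circle
  have hSne : S.Nonempty := ⟨EuclideanSpace.single 0 1, by simp [hS]⟩
  obtain ⟨um, humS, hum⟩ := hSc.exists_isMinOn hSne (continuous_norm.comp_continuousOn hLc)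
  set c : ℝ := ‖L um‖ with hc
  have hcpos : 0 < c := norm_pos_iff.2 (hL0 um humS)
  have hcle : ∀ u ∈ S, c ≤ ‖L u‖ := fun u hu => hum hu
  -- uniform smallness of `D - L` near `t = 0`
  have hK : IsCompact (S ×ˢ Icc (0 : ℝ) s) := hSc.prod isCompact_Icc
  have hEc : ContinuousOn (fun p : EuclideanSpace ℝ (Fin 2) × ℝ => D p - L p.1) (S ×ˢ Icc 0 s) :=
    hDc.sub (hLc.comp continuous_fst.continuousOn fun p hp => hp.1)
  obtain ⟨δ, hδ, hδE⟩ := Metric.uniformContinuousOn_iff.1 (hK.uniformContinuousOn_of_continuous hEc) (c / 2) (by linarith)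
  set t₁ : ℝ := min s (δ / 2) with ht₁
  have ht₁pos : 0 < t₁ := lt_min hs (by linarith)
  have ht₁s : t₁ ≤ s := min_le_left _ _
  have ht₁δ : t₁ < δ := lt_of_le_of_lt (min_le_right _ _) (by linarith)
  have hsmall : ∀ u ∈ S, ∀ τ ∈ Icc (0 : ℝ) t₁, ‖D (u, τ) - L u‖ < c / 2 := by
    intro u hu τ hτ
    have hτs : τ ∈ Icc (0 : ℝ) s := ⟨hτ.1, hτ.2.trans ht₁s⟩
    have h0s : (0 : ℝ) ∈ Icc (0 : ℝ) s := ⟨le_rfl, hs.le⟩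
    have hd : dist ((u, τ) : EuclideanSpace ℝ (Fin 2) × ℝ) (u, 0) < δ := by
      rw [Prod.dist_eq, dist_self, Real.dist_eq, sub_zero, abs_of_nonneg hτ.1, max_lt_iff]
      exact ⟨hδ, lt_of_le_of_lt hτ.2 ht₁δ⟩
    have h := hδE (u, τ) ⟨hu, hτs⟩ (u, 0) ⟨hu, h0s⟩ hd
    rw [dist_eq_norm] at h
    have hD0 : D (u, 0) - L u = 0 := by rw [hD]; simp only; rw [hL u hu, sub_self]
    simpa [hD0] using h
  -- mean value: `|Ψ(u, t₁) - t₁ L(u)| ≤ (c/2) t₁`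
  have hmv : ∀ u ∈ S, ‖Ψ (u, t₁) - t₁ • L u‖ ≤ c / 2 * t₁ := by
    intro u hu
    have hder : ∀ τ ∈ Icc (0 : ℝ) t₁, HasDerivWithinAt (fun τ : ℝ => Ψ (u, τ) - τ • L u) (D (u, τ) - L u) (Icc 0 t₁) τ := by
      intro τ hτ
      have hτs : τ ∈ Icc (0 : ℝ) s := ⟨hτ.1, hτ.2.trans ht₁s⟩
      have h1 : HasFDerivAt Ψ (fderiv ℝ Ψ (u, τ)) (u, τ) := ((hΨ u hu τ hτs).differentiableAt (by norm_num)).hasFDerivAt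
      have h2 : HasDerivAt (fun τ' : ℝ => ((u, τ') : EuclideanSpace ℝ (Fin 2) × ℝ)) ((0 : EuclideanSpace ℝ (Fin 2)), (1 : ℝ)) τ := by
        have := (hasDerivAt_const τ u).prodMk (hasDerivAt_id τ)
        simpa using this
      have h3 : HasDerivAt (fun τ' : ℝ => Ψ (u, τ')) (D (u, τ)) τ := h1.comp_hasDerivAt τ h2
      have h4 : HasDerivAt (fun τ' : ℝ => τ' • L u) (L u) τ := by simpa using (hasDerivAt_id τ).smul_const (L u)
      exact (h3.sub h4).hasDerivWithinAt
    have h := norm_image_sub_le_of_norm_deriv_le_segment' hder (fun τ hτ => (hsmall u hu τ ⟨hτ.1, hτ.2.le⟩).le) t₁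
      ⟨ht₁pos.le, le_rfl⟩
    simpa [hΨ0 u hu] using h
  -- the straight segment from `L u` to `Ψ(u, t₁)` misses the origin
  have hseg : ∀ u ∈ S, ∀ sg ∈ Icc (0 : ℝ) 1, (1 - sg) • L u + sg • Ψ (u, t₁) ≠ 0 := by
    intro u hu sg hsg h0
    have hLu := hcle u hu
    have hm := hmv u hu
    -- `(1 - sg + sg t₁) L u = -sg (Ψ - t₁ L)`
    have hΨeq : sg • Ψ (u, t₁) = -((1 - sg) • L u) := eq_neg_of_add_eq_zero_right h0
    have key : ((1 - sg) + sg * t₁) • L u = -(sg • (Ψ (u, t₁) - t₁ • L u)) := by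
      calc ((1 - sg) + sg * t₁) • L u = (1 - sg) • L u + (sg * t₁) • L u := add_smul _ _ _
        _ = -(sg • Ψ (u, t₁)) + sg • (t₁ • L u) := by rw [hΨeq, neg_neg, smul_smul]
        _ = -(sg • (Ψ (u, t₁) - t₁ • L u)) := by rw [smul_sub]; abel
    have hcoef : 0 ≤ (1 - sg) + sg * t₁ := by nlinarith [hsg.1, hsg.2, ht₁pos]
    have hn : ((1 - sg) + sg * t₁) * ‖L u‖ ≤ sg * (c / 2 * t₁) := by
      have := congrArg norm key
      rw [norm_smul, norm_neg, norm_smul, Real.norm_of_nonneg hcoef, Real.norm_of_nonneg hsg.1] at this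
      rw [this]
      exact mul_le_mul_of_nonneg_left hm hsg.1
    have h1' : ((1 - sg) + sg * t₁) * c ≤ ((1 - sg) + sg * t₁) * ‖L u‖ := mul_le_mul_of_nonneg_left hLu hcoef
    rcases eq_or_lt_of_le hsg.2 with h1 | h1
    · rw [h1] at hn h1'
      nlinarith [mul_pos ht₁pos hcpos]
    · nlinarith [mul_pos (sub_pos.2 h1) hcpos, mul_nonneg (mul_nonneg hsg.1 ht₁pos.le) hcpos.le]
  -- the two homotopies, as homotopies of maps into the punctured plane
  let Y := {v : EuclideanSpace ℝ (Fin 2) // v ≠ 0}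
  let f₀ : C((sphere (0 : EuclideanSpace ℝ (Fin 2)) 1), Y) :=
    ⟨fun u => ⟨L u, hL0 u u.2⟩, (hLc.comp_continuous continuous_subtype_val fun u => u.2).subtype_mk _⟩
  have hΨt : ∀ t ∈ Icc (0 : ℝ) s, Continuous fun u : (sphere (0 : EuclideanSpace ℝ (Fin 2)) 1) => Ψ (u, t) := fun t ht =>
    hΨc.comp_continuous (continuous_subtype_val.prodMk continuous_const) fun u => ⟨u.2, ht⟩
  let f₁ : C((sphere (0 : EuclideanSpace ℝ (Fin 2)) 1), Y) :=
    ⟨fun u => ⟨Ψ (u, t₁), hne u u.2 t₁ ht₁pos ht₁s⟩, (hΨt t₁ ⟨ht₁pos.le, ht₁s⟩).subtype_mk _⟩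
  let f₂ : C((sphere (0 : EuclideanSpace ℝ (Fin 2)) 1), Y) :=
    ⟨fun u => ⟨Ψ (u, s), hne u u.2 s hs le_rfl⟩, (hΨt s ⟨hs.le, le_rfl⟩).subtype_mk _⟩
  have H₁ : ContinuousMap.Homotopy f₀ f₁ :=
    { toFun := fun p => ⟨(1 - (p.1 : ℝ)) • L p.2 + (p.1 : ℝ) • Ψ (p.2, t₁), hseg p.2 p.2.2 p.1 ⟨p.1.2.1, p.1.2.2⟩⟩
      continuous_toFun := by
        refine Continuous.subtype_mk ?_ _
        have hsg : Continuous fun p : I × (sphere (0 : EuclideanSpace ℝ (Fin 2)) 1) => (p.1 : ℝ) :=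
          continuous_subtype_val.comp continuous_fst
        have hLp : Continuous fun p : I × (sphere (0 : EuclideanSpace ℝ (Fin 2)) 1) => L p.2 :=
          (hLc.comp_continuous continuous_subtype_val fun u => u.2).comp continuous_snd
        have hΨp : Continuous fun p : I × (sphere (0 : EuclideanSpace ℝ (Fin 2)) 1) => Ψ (p.2, t₁) :=
          (hΨt t₁ ⟨ht₁pos.le, ht₁s⟩).comp continuous_snd
        exact ((continuous_const.sub hsg).smul hLp).add (hsg.smul hΨp)
      map_zero_left := fun u => by apply Subtype.ext; simp [f₀]
      map_one_left := fun u => by apply Subtype.ext; simp [f₁] }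
  have H₂ : ContinuousMap.Homotopy f₁ f₂ :=
    { toFun := fun p => ⟨Ψ (p.2, t₁ + (p.1 : ℝ) * (s - t₁)), hne p.2 p.2.2 _
          (by nlinarith [p.1.2.1, p.1.2.2, ht₁pos, ht₁s]) (by nlinarith [p.1.2.1, p.1.2.2, ht₁pos, ht₁s])⟩
      continuous_toFun := by
        refine Continuous.subtype_mk ?_ _
        refine hΨc.comp_continuous ((continuous_subtype_val.comp continuous_snd).prodMk
          (continuous_const.add ((continuous_subtype_val.comp continuous_fst).mul continuous_const))) fun p => ⟨p.2.2, ?_, ?_⟩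
        · nlinarith [p.1.2.1, p.1.2.2, ht₁pos, ht₁s]
        · nlinarith [p.1.2.1, p.1.2.2, ht₁pos, ht₁s]
      map_zero_left := fun u => by apply Subtype.ext; simp [f₁]
      map_one_left := fun u => by apply Subtype.ext; simp [f₂] }
  let H := H₁.trans H₂
  refine ⟨fun p => (H p : Y).1, continuous_subtype_val.comp H.continuous, fun p => (H p).2, fun u => ?_, fun u => ?_⟩
  · show ((H (0, u) : Y) : EuclideanSpace ℝ (Fin 2)) = L u
    rw [H.apply_zero]; rfl
  · show ((H (1, u) : Y) : EuclideanSpace ℝ (Fin 2)) = Ψ (u, s)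
    rw [H.apply_one]; rfl

end FriendsCarrierVk

open FriendsCarrierVk in
/-- **Helper `helper_friendsCarrier_Vk_partA_pushHomotopy`** (piece of `helper_friendsCarrier_Vk_partA`: the
first-order homotopy of a shrinking family of loops).  Let `Ψ : ℝ² × ℝ → ℝ²` be `C¹` at the points of
`𝕊¹ × [0, s]` (`s > 0`) with `Ψ(u, 0) = 0`, `∂ₜΨ(u, 0) = L(u) ≠ 0` (`L` continuous on the circle) and
`Ψ(u, t) ≠ 0` for `0 < t ≤ s`, `u ∈ 𝕊¹`.  Then `L` and `Ψ(·, s)` are freely homotopic as loops of `ℝ² ∖ 0`.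
[cite: Hirsch1976, Ch. 4 §5] -/
theorem helper_friendsCarrier_Vk_partA_pushHomotopy : ∀ (Ψ : EuclideanSpace ℝ (Fin 2) × ℝ → EuclideanSpace ℝ (Fin 2)) (L : EuclideanSpace ℝ (Fin 2) → EuclideanSpace ℝ (Fin 2)) (s : ℝ), 0 < s → (∀ u ∈ Metric.sphere (0 : EuclideanSpace ℝ (Fin 2)) 1, ∀ t ∈ Set.Icc 0 s, ContDiffAt ℝ 1 Ψ (u, t)) → (∀ u ∈ Metric.sphere (0 : EuclideanSpace ℝ (Fin 2)) 1, Ψ (u, 0) = 0) → (∀ u ∈ Metric.sphere (0 : EuclideanSpace ℝ (Fin 2)) 1, fderiv ℝ Ψ (u, 0) ((0 : EuclideanSpace ℝ (Fin 2)), (1 : ℝ)) = L u) → (∀ u ∈ Metric.sphere (0 : EuclideanSpace ℝ (Fin 2)) 1, L u ≠ 0) → ContinuousOn L (Metric.sphere 0 1) → (∀ u ∈ Metric.sphere (0 : EuclideanSpace ℝ (Fin 2)) 1, ∀ t : ℝ, 0 < t → t ≤ s → Ψ (u, t) ≠ 0) → ∃ G : unitInterval × (Metric.sphere (0 : EuclideanSpace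 ℝ (Fin 2)) 1) → EuclideanSpace ℝ (Fin 2), Continuous G ∧ (∀ p, G p ≠ 0) ∧ (∀ u, G (0, u) = L u) ∧ ∀ u, G (1, u) = Ψ (u, s) := by
  intro Ψ L s hs hΨ hΨ0 hL hL0 hLc hne
  exact exists_pushHomotopy Ψ L s hs hΨ hΨ0 hL hL0 hLc hne

end Summit.SmoothPoincare4.SmoothPoincare4.Theorems.DcrGap.MkFriends

end
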